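import Mathlib
import Summits.QuantumAdvantage.QuantumAdvantage.Theorems.MobiusLadderDigitPolyUniformityLowAffine

/-!
# Crux `DigitPolyUniformity` (stmt-QuantumAdvantage-1392), line `Sketch` (LAR composition):
# the mirror forms from averaged short-interval Walsh uniformity at scale `2^{⌊n/2⌋}`

The mirror forms `Σ_{i<m} x_i x_{n−1−i}` (`m ≤ ⌊n/2⌋`) — the named hard case stmt-1391 of the
crux — are AFFINE IN THE LOW `⌊n/2⌋` DIGITS: for `i < m ≤ ⌊n/2⌋` the partner digit
`n − 1 − i ≥ ⌊n/2⌋` is a high digit, so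
`Σ_{i<m} bit_i(N) bit_{n−1−i}(N) = Σ_{i<⌊n/2⌋} bit_i(N) ℓ_i(y)` with `y = ⌊N / 2^{⌊n/2⌋}⌋` and
`ℓ_i(y) = [i < m] · bit_{n−1−i−⌊n/2⌋}(y)`. Hence the landed low-affine theorem
`digitPolyUniformity_lowAffine_of_shortWalsh`
(`Theorems/MobiusLadderDigitPolyUniformityLowAffine.lean`) at the balanced cut `h(n) = ⌊n/2⌋`
gives their `λ`-uniformity from averaged short-interval Walsh uniformity of `λ` at scale
`2^{⌊n/2⌋}` (`digitPolyUniformity_mirror_of_shortWalsh`). Pure finite sums; no named facts.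
-/

namespace Summit.QuantumAdvantage.DigitPolyUniformity.SketchLAR

open Filter Finset

namespace MirrorOfShortWalsh

/-- Reindexing: for `m ≤ n`, a sum over `{i : Fin n | i < m}` of a function of `(i : ℕ)` is the sum
over `range m`. [folklore] -/
theorem sum_filter_val_lt {M : Type*} [AddCommMonoid M] {n m : ℕ} (hm : m ≤ n) (F : ℕ → M) :
    ∑ i ∈ (Finset.univ : Finset (Fin n)).filter (fun i : Fin n => (i : ℕ) < m), F i =
      ∑ j ∈ Finset.range m, F j := by
  rw [Finset.sum_filter, Fin.sum_univ_eq_sum_range (fun j => if j < m then F j else 0) n,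
    ← Finset.sum_filter]
  refine Finset.sum_congr ?_ fun _ _ => rfl
  ext j
  simp only [Finset.mem_filter, Finset.mem_range]
  omega

/-- The mirror form `Σ_{i<m} x_i x_{n−1−i}`, `m ≤ ⌊n/2⌋`, is affine in the low `⌊n/2⌋` digits:
at the digits of `N`,
`Σ_{i<m} bit_i(N) bit_{n−1−i}(N) = Σ_{i<⌊n/2⌋} bit_i(N) · ([i < m] bit_{n−1−i−⌊n/2⌋}(⌊N/2^{⌊n/2⌋}⌋))`.
[folklore] -/
theorem eval_mirror_eq_lowAffine (n m N : ℕ) (hm : m ≤ n / 2) :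
    MvPolynomial.eval (fun i : Fin n => if Nat.testBit N i then (1 : ZMod 2) else 0)
        (∑ i ∈ (Finset.univ : Finset (Fin n)).filter (fun i : Fin n => i.val < m),
          MvPolynomial.X i * MvPolynomial.X (Fin.rev i)) =
      ∑ i : Fin (n / 2), (if Nat.testBit N i then (1 : ZMod 2) else 0) *
        (if (i : ℕ) < m then
          (if Nat.testBit (N / 2 ^ (n / 2)) (n - 1 - i - n / 2) then (1 : ZMod 2) else 0) else 0) := by
  simp only [map_sum, map_mul, MvPolynomial.eval_X, Fin.val_rev, Nat.testBit_div_two_pow]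
  -- both sides are `Σ_{j<m} bit_j(N) bit_{n−1−j}(N)`, reindexed over `range m`
  calc ∑ i ∈ (Finset.univ : Finset (Fin n)).filter (fun i : Fin n => (i : ℕ) < m),
          (if Nat.testBit N i then (1 : ZMod 2) else 0) *
            (if Nat.testBit N (n - (i + 1)) then (1 : ZMod 2) else 0)
      = ∑ j ∈ Finset.range m, (if Nat.testBit N j then (1 : ZMod 2) else 0) *
          (if Nat.testBit N (n - (j + 1)) then (1 : ZMod 2) else 0) :=
        sum_filter_val_lt (hm.trans (Nat.div_le_self n 2))
          (fun j => (if Nat.testBit N j then (1 : ZMod 2) else 0) *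
            (if Nat.testBit N (n - (j + 1)) then (1 : ZMod 2) else 0))
    _ = ∑ j ∈ Finset.range m, (if Nat.testBit N j then (1 : ZMod 2) else 0) *
          (if Nat.testBit N (n - 1 - j - n / 2 + n / 2) then (1 : ZMod 2) else 0) := by
        refine Finset.sum_congr rfl fun j hj => ?_
        rw [Finset.mem_range] at hj
        rw [show n - 1 - j - n / 2 + n / 2 = n - (j + 1) by omega]
    _ = ∑ i ∈ (Finset.univ : Finset (Fin (n / 2))).filter (fun i : Fin (n / 2) => (i : ℕ) < m),
          (if Nat.testBit N i then (1 : ZMod 2) else 0) *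
            (if Nat.testBit N (n - 1 - i - n / 2 + n / 2) then (1 : ZMod 2) else 0) :=
        (sum_filter_val_lt hm (fun j => (if Nat.testBit N j then (1 : ZMod 2) else 0) *
          (if Nat.testBit N (n - 1 - j - n / 2 + n / 2) then (1 : ZMod 2) else 0))).symm
    _ = ∑ i : Fin (n / 2), (if Nat.testBit N i then (1 : ZMod 2) else 0) *
          (if (i : ℕ) < m then
            (if Nat.testBit N (n - 1 - i - n / 2 + n / 2) then (1 : ZMod 2) else 0) else 0) := by
        rw [Finset.sum_filter]
        exact Finset.sum_congr rfl fun i _ => (mul_ite_zero _ _ _).symm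

end MirrorOfShortWalsh

open MirrorOfShortWalsh in
/-- **The mirror forms (stmt-1391's named hard case) from short-interval Walsh uniformity at
scale `2^{⌊n/2⌋}`.** Under the hypothesis of `digitPolyUniformity_lowAffine_of_shortWalsh` with
the balanced cut `h(n) = ⌊n/2⌋` — for every `ε > 0`, eventually in `n`, for every selection
`σ : y ↦ S_y ⊆ {0..⌊n/2⌋−1}`,
`Σ_{y < 2^{n−⌊n/2⌋}} |Σ_{x < 2^{⌊n/2⌋}} λ(2^{⌊n/2⌋} y + x) w_{S_y}(x)| ≤ ε 2ⁿ` — every mirror form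
`Σ_{i<m} x_i x_{n−1−i}`, `m ≤ ⌊n/2⌋`, is `λ`-uniform:
`|Σ_{N<2ⁿ} λ(N) (−1)^{Σ_{i<m} bit_i(N) bit_{n−1−i}(N)}| ≤ ε 2ⁿ`.
Proof: it is affine in the low half (for `i < m ≤ ⌊n/2⌋` the partner digit `n−1−i ≥ ⌊n/2⌋` is a
high digit, `eval_mirror_eq_lowAffine`), so the low-affine theorem applies with
`ℓ_i(y) = [i < m] bit_{n−1−i−⌊n/2⌋}(y)`, `g = 0`. [folklore] -/
theorem digitPolyUniformity_mirror_of_shortWalsh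
    (hSIW : ∀ ε : ℝ, 0 < ε → ∀ᶠ n : ℕ in atTop, ∀ σ : ℕ → Finset (Fin (n / 2)),
      ∑ y ∈ Finset.range (2 ^ (n - n / 2)),
        |∑ x ∈ Finset.range (2 ^ (n / 2)),
            ((ArithmeticFunction.liouville (2 ^ (n / 2) * y + x) : ℤ) : ℝ) *
              ∏ i ∈ σ y, (if Nat.testBit x i then (-1 : ℝ) else 1)| ≤ ε * (2 : ℝ) ^ n) :
    ∀ ε : ℝ, 0 < ε → ∀ᶠ n : ℕ in atTop, ∀ m : ℕ, m ≤ n / 2 →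
      |∑ N ∈ Finset.range (2 ^ n), ((ArithmeticFunction.liouville N : ℤ) : ℝ) *
          (if MvPolynomial.eval (fun i : Fin n => if Nat.testBit N i then (1 : ZMod 2) else 0)
              (∑ i ∈ (Finset.univ : Finset (Fin n)).filter (fun i : Fin n => i.val < m),
                MvPolynomial.X i * MvPolynomial.X (Fin.rev i)) = 1
            then (-1 : ℝ) else 1)| ≤ ε * (2 : ℝ) ^ n := by
  intro ε hε
  filter_upwards [digitPolyUniformity_lowAffine_of_shortWalsh (fun n => n / 2)
    (fun n => Nat.div_le_self n 2) hSIW ε hε] with n hn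
  intro m hm
  refine hn _ ⟨fun i y => if (i : ℕ) < m then
      (if Nat.testBit y (n - 1 - i - n / 2) then (1 : ZMod 2) else 0) else 0,
    fun _ => 0, fun N _ => ?_⟩
  rw [add_zero]
  exact eval_mirror_eq_lowAffine n m N hm

end Summit.QuantumAdvantage.DigitPolyUniformity.SketchLAR
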